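import Summits.BirchSwinnertonDyer.BirchSwinnertonDyer.Theorems.KolyvaginRoadThreeMethod2TameSign
import Summits.BirchSwinnertonDyer.BirchSwinnertonDyer.Theorems.KolyvaginRoadThreeMethod2CruxOfOddRank
import Summits.BirchSwinnertonDyer.BirchSwinnertonDyer.Theorems.KolyvaginRoadThreeMethod2OddSelmerRank
import HarnessLib

/-!
# Route `KolyvaginRoadThree`, deciding crux `ZhangSharpFrameAtThreeHL` (item stmt-BirchSwinnertonDyer-19574):
# the registered stub A `stub_levelRaisingAtThree` (v2x text) from (Cheb) + (Iso) ONLY —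
# (Line), (Trans) and (Equiv) are kernel theorems
# (cell `bsd-stepL`, seat `bsd-stepL-zhang3-p1` g7; `--supports stmt-BirchSwinnertonDyer-19574`, helper)

WHY THIS FILE. koly3a's reduction of the REGISTERED stub A of crux 19574 (`Method2.stub_levelRaisingAtThree_v2w_of_
localGlobal`, p467211; skeleton v2x of koly g12, text byte-identical) asked five local–global inputs at the good
unipotent-admissible primes. Three are now PROVED for the frame's fields (`[K : ℚ] = 2`):
(Line) ∕ (Trans) — `KolyvaginRoadThreeMethod2LocalInputsLineTrans` (`localLine_of_uAdmissible`,
`localTrans_of_uAdmissible`); (Equiv) — `KolyvaginRoadThreeMethod2LocalEquivOfTame` + `KolyvaginRoadThreeMethod2TameSign`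
(`localEquiv_of_uAdmissible`: the tame sign law from the tree's local Serre theory). What remains of stub A is exactly:
(Cheb) — Čebotarev with the sign rule at `p = 3` (W. Zhang Lemma 7.3 ∕ Bertolini–Darmon Thm 3.2; koly MEMO-v8 §4: a
non-zero class of `SelQ n μ` is detected at some GOOD unipotent-admissible `q ∉ n`), and (Iso) — Poitou–Tate isotropy
(Zhang Prop. 5.4; MEMO-v8 §5; tree suppliers `GaloisCohomology/PoitouTate*`, koly g12's roadmap). This file records
the two-input reduction: the registered stub signature VERBATIM as conclusion; and, composing with koly3a's
`zhangSharpFrameAtThreeHL_of_rankLowering_of_classes_of_oddSelmerRank` (p466248) and koly g12's stub P from published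
facts (`stub_oddSelmerRankAtThree_of_published`, p465420), THE ROUTE DECL BY NAME ⟸ (Cheb) + (Iso) + stub B + four
PUBLISHED named facts (Gross–Zagier, Kolyvagin, modularity, Cassels–Tate). CONDITIONAL on those binders; nothing is
booked; neither the stub nor the crux is proved; the owner assembles.
PARTITION: O2@3 (B10) × A1 × crux 19574 × stub A — none (reduction of a registered stub to two named inputs; T7).

References: [cite: WZhang2014, Prop. 5.4, Lemma 7.3, §9 (9.1)–(9.3)] [cite: BertoliniDarmon2005, Lemma 2.6, Thm. 3.2]
[cite: SerreInventiones1972, §1.8 Prop. 6].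
-/

noncomputable section

open scoped Classical

namespace Summit.BirchSwinnertonDyer.Rank1Residual.X11b.Three.Koly.Method2

open WeierstrassCurve NumberField IsDedekindDomain Field
  Literature.NumberTheory.EllipticCurves Literature.NumberTheory.EllipticCurves.ModularForms
  Literature.NumberTheory.EllipticCurves.Rank1Residual Literature.NumberTheory.GaloisRepresentations
  Summit.BirchSwinnertonDyer.Rank1Residual Summit.BirchSwinnertonDyer.Rank1Residual.X11b Module

/-- **`stub_levelRaisingAtThree` — the REGISTERED v2x text — FROM (Cheb) + (Iso) ONLY, frame-wise.** At every
Hoffstein–Luo A1 frame (`K` imaginary quadratic, so `[K : ℚ] = 2`) and every complex conjugation `c ≠ 1` with the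
`ZMod 3`-structure of `H¹(K, E[3])`, the hypothesis asks only (Cheb) (a non-zero class of `SelQ n μ`, `n` good, has
non-zero localisation at some GOOD unipotent-admissible `q ∉ n`) and (Iso) (on a good level, at a good prime, the
localisations of two classes relaxed at `q` are proportional). The other three inputs of koly3a's
`selQ_rankLowering_on_of_localGlobal` are the kernel theorems `localEquiv_of_uAdmissible` (Zhang (9.2)),
`localLine_of_uAdmissible`, `localTrans_of_uAdmissible` (Bertolini–Darmon Lemma 2.6 at `p = 3`). The conclusion is the
registered stub signature VERBATIM. CONDITIONAL on the two binders; nothing is booked.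
[cite: WZhang2014, Prop. 5.4, Lemma 7.3, §9 (9.1)–(9.3)] [cite: BertoliniDarmon2005, Lemma 2.6, Thm. 3.2] -/
theorem stub_levelRaisingAtThree_of_cheb_iso
    (hLG : ∀ (W : WeierstrassCurve ℚ) [W.IsElliptic] [W.IsGloballyMinimal] [NeZero (W.conductorNorm ℤ)] (K : Type)
      [Field K] [NumberField K] (Dt : ModularParametrizationData W (W.conductorNorm ℤ)) (β : ℤ) (ι : K →+* ℂ),
      Summit.BirchSwinnertonDyer.Rank1Residual.ClassX11b W 3 → W.HasMultiplicativeReductionAtPrime 3 →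
      Literature.NumberTheory.EllipticCurves.Rank1Residual.Surj W 3 →
      Literature.NumberTheory.EllipticCurves.Rank1Residual.Ram W 3 → ¬ 3 ∣ W.tamagawaProduct →
      IsImaginaryQuadratic K → Odd (NumberField.discr K) → SatisfiesHeegnerHypothesis (W.conductorNorm ℤ) K →
      (W.quadraticTwist (NumberField.discr K : ℚ)).entireLFunction 1 ≠ 0 → NumberField.discr K ≠ -3 →
      (4 * (W.conductorNorm ℤ : ℤ)) ∣ β ^ 2 - NumberField.discr K → ¬ (3 : ℤ) ∣ Dt.c →
      ∀ (c : K ≃ₐ[ℚ] K), c ≠ 1 → ∀ [Module (ZMod 3) (V3 W K)],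
      -- (Cheb)
      (∀ (n : Finset {q // IsUAdmissiblePrime W K q}) (μ : Bool) (x : V3 W K), GoodLevel W K n →
        x ∈ SelQ W K c n μ → x ≠ 0 →
        ∃ q : {q // IsUAdmissiblePrime W K q}, q ∉ n ∧ FrobSqNeOneAt W 3 q.1 ∧ ∃ v : HeightOneSpectrum (𝓞 K),
          ((q : ℕ) : 𝓞 K) ∈ v.asIdeal ∧
            (W.baseChange K).torsionLocMap (v.adicCompletion K) ((3 ^ 1 : ℕ) : ℤ) x ≠ 0) ∧
      -- (Iso)
      (∀ (n : Finset {q // IsUAdmissiblePrime W K q}) (q : {q // IsUAdmissiblePrime W K q}) (μ : Bool),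
        GoodLevel W K n → FrobSqNeOneAt W 3 q.1 → q ∉ n →
        ∀ v : HeightOneSpectrum (𝓞 K), ((q : ℕ) : 𝓞 K) ∈ v.asIdeal →
        ∀ y ∈ SelRelQ W K c (insert q n) {q} μ, ∀ z ∈ SelRelQ W K c (insert q n) {q} μ,
          (W.baseChange K).torsionLocMap (v.adicCompletion K) ((3 ^ 1 : ℕ) : ℤ) z ≠ 0 →
          ∃ a : ℤ, (W.baseChange K).torsionLocMap (v.adicCompletion K) ((3 ^ 1 : ℕ) : ℤ) y =
            a • (W.baseChange K).torsionLocMap (v.adicCompletion K) ((3 ^ 1 : ℕ) : ℤ) z)) :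
    ∀ (W : WeierstrassCurve ℚ) [W.IsElliptic] [W.IsGloballyMinimal] [NeZero (W.conductorNorm ℤ)] (K : Type)
      [Field K] [NumberField K] (Dt : ModularParametrizationData W (W.conductorNorm ℤ)) (β : ℤ) (ι : K →+* ℂ),
      Summit.BirchSwinnertonDyer.Rank1Residual.ClassX11b W 3 → W.HasMultiplicativeReductionAtPrime 3 →
      Literature.NumberTheory.EllipticCurves.Rank1Residual.Surj W 3 →
      Literature.NumberTheory.EllipticCurves.Rank1Residual.Ram W 3 → ¬ 3 ∣ W.tamagawaProduct →
      IsImaginaryQuadratic K → Odd (NumberField.discr K) → SatisfiesHeegnerHypothesis (W.conductorNorm ℤ) K →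
      (W.quadraticTwist (NumberField.discr K : ℚ)).entireLFunction 1 ≠ 0 → NumberField.discr K ≠ -3 →
      (4 * (W.conductorNorm ℤ : ℤ)) ∣ β ^ 2 - NumberField.discr K → ¬ (3 : ℤ) ∣ Dt.c →
      ∀ (c : K ≃ₐ[ℚ] K), c ≠ 1 → ∀ [Module (ZMod 3) (V3 W K)],
      -- (A1) rank lowering at one new GOOD (non-scalar) unipotent-admissible prime, on good levels, (9.1)–(9.2)
      (∀ (n : Finset {q // IsUAdmissiblePrime W K q}) (μ : Bool) (x : V3 W K),
        GoodLevel W K n → x ∈ SelQ W K c n μ → x ≠ 0 →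
        ∃ q : {q // IsUAdmissiblePrime W K q}, q ∉ n ∧ GoodLevel W K (insert q n) ∧
          x ∉ SelQ W K c (insert q n) μ ∧
          SelQ W K c (insert q n) μ ≤ SelQ W K c n μ ∧
          finrank (ZMod 3) (SelQ W K c (insert q n) μ) + 1 = finrank (ZMod 3) (SelQ W K c n μ) ∧
          SelQ W K c (insert q n) (!μ) = SelQ W K c n (!μ)) := by
  intro W _ _ _ K _ _ Dt β ι hX hmult hsurj hram htam hK hodd hH hLt h3 hβ hc c hc1 _
  obtain ⟨hcheb, hiso⟩ := hLG W K Dt β ι hX hmult hsurj hram htam hK hodd hH hLt h3 hβ hc c hc1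
  exact selQ_rankLowering_on_of_localGlobal W K c hcheb (localEquiv_of_uAdmissible W K hK.1 hc1)
    (localLine_of_uAdmissible W K hK.1) (localTrans_of_uAdmissible W K hK.1) hiso

/-- **THE ROUTE DECL BY NAME from (Cheb) + (Iso) + stub B + four published facts.** Composition of
`stub_levelRaisingAtThree_of_cheb_iso` (this file: (Line), (Trans), (Equiv) are kernel theorems) with koly3a's
`zhangSharpFrameAtThreeHL_of_rankLowering_of_classes_of_oddSelmerRank` (Zhang's §9 induction on good levels, odd
start) and koly g12's `stub_oddSelmerRankAtThree_of_published` (3-parity of `Sel₃(E/K)` at a Hoffstein–Luo frame from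
Gross–Zagier, Kolyvagin, modularity and the Cassels–Tate pairing). Hypotheses: (Cheb) and (Iso) frame-wise (koly MEMO-v8
§§4–5); `hB` = the registered stub B `stub_kolyvaginClassesAtThree` text ((A2)(A3)(A5) realised by the Kolyvagin classes
— the crux's unprinted content at `p = 3`); the four named facts. CONDITIONAL; nothing is booked; the crux is NOT
claimed. [cite: WZhang2014, Thm. 9.1, §9 (9.1)–(9.3), Prop. 5.4, Lemma 7.3] [cite: GrossZagier1986, Thm. I.6.3]
[cite: Kolyvagin1990, Thm. A] -/
theorem zhangSharpFrameAtThreeHL_of_cheb_iso_of_classes_of_published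
    (hLG : ∀ (W : WeierstrassCurve ℚ) [W.IsElliptic] [W.IsGloballyMinimal] [NeZero (W.conductorNorm ℤ)] (K : Type)
      [Field K] [NumberField K] (Dt : ModularParametrizationData W (W.conductorNorm ℤ)) (β : ℤ) (ι : K →+* ℂ),
      Summit.BirchSwinnertonDyer.Rank1Residual.ClassX11b W 3 → W.HasMultiplicativeReductionAtPrime 3 →
      Literature.NumberTheory.EllipticCurves.Rank1Residual.Surj W 3 →
      Literature.NumberTheory.EllipticCurves.Rank1Residual.Ram W 3 → ¬ 3 ∣ W.tamagawaProduct →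
      IsImaginaryQuadratic K → Odd (NumberField.discr K) → SatisfiesHeegnerHypothesis (W.conductorNorm ℤ) K →
      (W.quadraticTwist (NumberField.discr K : ℚ)).entireLFunction 1 ≠ 0 → NumberField.discr K ≠ -3 →
      (4 * (W.conductorNorm ℤ : ℤ)) ∣ β ^ 2 - NumberField.discr K → ¬ (3 : ℤ) ∣ Dt.c →
      ∀ (c : K ≃ₐ[ℚ] K), c ≠ 1 → ∀ [Module (ZMod 3) (V3 W K)],
      -- (Cheb)
      (∀ (n : Finset {q // IsUAdmissiblePrime W K q}) (μ : Bool) (x : V3 W K), GoodLevel W K n →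
        x ∈ SelQ W K c n μ → x ≠ 0 →
        ∃ q : {q // IsUAdmissiblePrime W K q}, q ∉ n ∧ FrobSqNeOneAt W 3 q.1 ∧ ∃ v : HeightOneSpectrum (𝓞 K),
          ((q : ℕ) : 𝓞 K) ∈ v.asIdeal ∧
            (W.baseChange K).torsionLocMap (v.adicCompletion K) ((3 ^ 1 : ℕ) : ℤ) x ≠ 0) ∧
      -- (Iso)
      (∀ (n : Finset {q // IsUAdmissiblePrime W K q}) (q : {q // IsUAdmissiblePrime W K q}) (μ : Bool),
        GoodLevel W K n → FrobSqNeOneAt W 3 q.1 → q ∉ n →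
        ∀ v : HeightOneSpectrum (𝓞 K), ((q : ℕ) : 𝓞 K) ∈ v.asIdeal →
        ∀ y ∈ SelRelQ W K c (insert q n) {q} μ, ∀ z ∈ SelRelQ W K c (insert q n) {q} μ,
          (W.baseChange K).torsionLocMap (v.adicCompletion K) ((3 ^ 1 : ℕ) : ℤ) z ≠ 0 →
          ∃ a : ℤ, (W.baseChange K).torsionLocMap (v.adicCompletion K) ((3 ^ 1 : ℕ) : ℤ) y =
            a • (W.baseChange K).torsionLocMap (v.adicCompletion K) ((3 ^ 1 : ℕ) : ℤ) z))
    (hB : ∀ (W : WeierstrassCurve ℚ) [W.IsElliptic] [W.IsGloballyMinimal] [NeZero (W.conductorNorm ℤ)] (K : Type)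
      [Field K] [NumberField K] (Dt : ModularParametrizationData W (W.conductorNorm ℤ)) (β : ℤ) (ι : K →+* ℂ),
      Summit.BirchSwinnertonDyer.Rank1Residual.ClassX11b W 3 → W.HasMultiplicativeReductionAtPrime 3 →
      Literature.NumberTheory.EllipticCurves.Rank1Residual.Surj W 3 →
      Literature.NumberTheory.EllipticCurves.Rank1Residual.Ram W 3 → ¬ 3 ∣ W.tamagawaProduct →
      IsImaginaryQuadratic K → Odd (NumberField.discr K) → SatisfiesHeegnerHypothesis (W.conductorNorm ℤ) K →
      (W.quadraticTwist (NumberField.discr K : ℚ)).entireLFunction 1 ≠ 0 → NumberField.discr K ≠ -3 →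
      (4 * (W.conductorNorm ℤ : ℤ)) ∣ β ^ 2 - NumberField.discr K → ¬ (3 : ℤ) ∣ Dt.c →
      ∀ (c : K ≃ₐ[ℚ] K), c ≠ 1 → ∀ [Module (ZMod 3) (V3 W K)],
      ∃ (κ : {x : (n : ℕ) × KolyvaginHeegnerData Dt β ι n //
              KolyvaginDescent.KolSupp (Zhang2014.IsKolyvaginPrime (W.conductorNorm ℤ) W K 3) x.1} →
            Finset {q // IsUAdmissiblePrime W K q} → V3 W K)
        (m₁ : {x : (n : ℕ) × KolyvaginHeegnerData Dt β ι n //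
              KolyvaginDescent.KolSupp (Zhang2014.IsKolyvaginPrime (W.conductorNorm ℤ) W K 3) x.1}),
        (∀ m, κ m ∅ = m.1.2.kolyvaginClass Nat.prime_three 1) ∧
        (∀ (n : Finset {q // IsUAdmissiblePrime W K q}) (q₁ q₂ : {q // IsUAdmissiblePrime W K q}),
          GoodLevel W K n → GoodLevel W K (insert q₁ n) → GoodLevel W K (insert q₂ (insert q₁ n)) →
          q₁ ∉ n → q₂ ∉ insert q₁ n → q₂ ∉ baseLocusQ W K κ (insert q₂ (insert q₁ n)) → ∃ m, κ m n ≠ 0) ∧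
        (∀ (n : Finset {q // IsUAdmissiblePrime W K q}), GoodLevel W K n → Even n.card → (∃ m, κ m n ≠ 0) →
          ∃ (s : Bool) (d : ℕ), finrank (ZMod 3) (SelQ W K c n s) = d + 1 ∧
            SelQ W K c n s = SelRelQ W K c n (baseLocusQ W K κ n) s ∧
            FiniteDimensional (ZMod 3) (SelRelQ W K c n (baseLocusQ W K κ n) (!s)) ∧
            finrank (ZMod 3) (SelRelQ W K c n (baseLocusQ W K κ n) (!s)) ≤ d) ∧
        (∀ (n : Finset {q // IsUAdmissiblePrime W K q}), GoodLevel W K n → Even n.card →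
          finrank (ZMod 3) (SelQ W K c n true) + finrank (ZMod 3) (SelQ W K c n false) = 1 → κ m₁ n ≠ 0))
    (hGZ : ∀ (N : ℕ) [NeZero N] (W : WeierstrassCurve ℚ) (K : Type) [Field K] [NumberField K], gross_zagier N W K)
    (hKo : ∀ (N : ℕ) [NeZero N] (W : WeierstrassCurve ℚ) (K : Type) [Field K] [NumberField K], kolyvagin N W K)
    (hmod : hasEntireLFunction_rat)
    (hCT : ∀ (F : Type) [Field F] [NumberField F], exists_casselsTate_pairing (K := F)) :
    Summit.BirchSwinnertonDyer.BirchSwinnertonDyer.Theses.KolyvaginRoadThree.ZhangSharpFrameAtThreeHL :=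
  zhangSharpFrameAtThreeHL_of_rankLowering_of_classes_of_oddSelmerRank (stub_levelRaisingAtThree_of_cheb_iso hLG)
    hB (stub_oddSelmerRankAtThree_of_published hGZ hKo hmod hCT)

end Summit.BirchSwinnertonDyer.Rank1Residual.X11b.Three.Koly.Method2

end
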